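import Literature.Barriers.MatrixMultiplication.RectangularBarrierUpperSupportProofs
import Literature.Computability.AlgebraicComplexity.UpperSupportFunctionalMatMul
import HarnessLib

/-!
# Proof of CLLZ Lemma 4.1: the upper support functional of a matrix multiplication tensor

Topic `Literature/Barriers/MatrixMultiplication`; a sibling proofs file of `RectangularBarrier.lean`
(next to `RectangularBarrierProofs.lean`, Rem. 3.23, and `RectangularBarrierUpperSupportProofs.lean`,
Lemma 4.2 (v)) discharging its named fact `CLLZ2025_lem41` (Christandl–Le Gall–Lysikov–Zuiddam,
*Barriers for rectangular matrix multiplication*, comput. complexity 34 (2025) = arXiv:2003.03019,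
Lemma 4.1): for every field `K`, every `θ ∈ P([3])` and all `a, b, c ≥ 1`,
`ζ^θ(⟨a,b,c⟩) = a^{θ 0+θ 1} b^{θ 1+θ 2} c^{θ 0+θ 2}` in the tree's index convention
(`matMulTensor K a b c : (Fin a × Fin c) → (Fin a × Fin b) → (Fin b × Fin c) → K`; printed as
`a^{θ₁+θ₃} b^{θ₁+θ₂} c^{θ₂+θ₃}` for CLLZ's labelling `ab, bc, ca` of the three factors).

The printed proof is "One verifies this by a direct computation. See also [Str91]." The tree's proof
is Strassen's ([Str91, §4]; CVZ 2023 §2): `Literature/Computability/AlgebraicComplexity/`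
`UpperSupportFunctionalMatMul.lean` proves `ρ^θ(t) = H_θ(supp t)` for tensors whose standard support
is an antichain (CVZ Thm. 2.19 — via a maximiser of `H_θ` and its first-order conditions,
`WeightedEntropyMax.lean`, and Strassen's permutation lemma CVZ Prop. 2.16, `SupportFlags.lean`) and
evaluates it on the tight support of `⟨a,b,c⟩` with the uniform distribution
(`upperSupportFunctional_matMulTensor`).

* `CLLZ2025_lem41_holds : CLLZ2025_lem41`.
* `isAdequate_upperSupportPoint_of_strassen` — with Lemma 4.1 and Lemma 4.2 (v)
  (`CLLZ2025_lem42_v_holds`) both discharged, the adequacy of `ζ^θ` (CLLZ Lemma 4.2,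
  `CLLZ2025_lem42`) is conditional only on Strassen's theorem `Strassen1991_upperSupportFunctional`
  ((i), (ii), (iv), normalisation; CVZ Thm. 2.4).
-/

noncomputable section

namespace Literature.Barriers.MatrixMultiplication

/-- **CLLZ Lemma 4.1 (Strassen 1991), PROVED:** for every field `K`, `θ ∈ P([3])` and `a, b, c ≥ 1`,
`ζ^θ(⟨a,b,c⟩) = a^{θ 0+θ 1} b^{θ 1+θ 2} c^{θ 0+θ 2}` — the named fact `CLLZ2025_lem41` of
`RectangularBarrier.lean` holds (`upperSupportFunctional_matMulTensor`).
[cite: ChristandlLeGallLysikovZuiddam2025, Lemma 4.1] -/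
theorem CLLZ2025_lem41_holds : CLLZ2025_lem41 :=
  fun K _ _θ hθ _a _b _c ha hb hc =>
    Literature.Computability.AlgebraicComplexity.upperSupportFunctional_matMulTensor (K := K) hθ ha hb hc

/-- With Lemma 4.1 and Lemma 4.2 (v) discharged, **CLLZ Lemma 4.2 — the upper support functionals
`ζ^θ` are adequate — holds conditionally only on Strassen's theorem**
(`Strassen1991_upperSupportFunctional`: (i), (ii), (iv) and normalisation).
[cite: ChristandlLeGallLysikovZuiddam2025, Lemma 4.2] -/
theorem isAdequate_upperSupportPoint_of_strassen
    (hS : Literature.Computability.AlgebraicComplexity.Strassen1991_upperSupportFunctional.{0})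
    (K : Type) [Field K] {θ : Fin 3 → ℝ} (hθ : θ ∈ stdSimplex ℝ (Fin 3)) :
    IsAdequate K (upperSupportPoint K θ) :=
  CLLZ2025_lem42 hS CLLZ2025_lem41_holds CLLZ2025_lem42_v_holds K hθ

end Literature.Barriers.MatrixMultiplication

end
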